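import Mathlib
import Literature.NumberTheory.LFunctions.Zhang2022.Section18RangeToolsB
import HarnessLib

/-!
# Zhang (2022) §18, proof of (2.33): the termwise majorant of a `dr`-range piece, the mass of a
# `T`-window, and `T^{−c}` against powers of `𝓛`

Topic `Literature/NumberTheory/LFunctions/Zhang2022` (Landau–Siegel audit tree; verdict-neutral).
Y. Zhang, *Discrete mean estimates and the Landau–Siegel zero*, arXiv:2211.02515v1 (2022)
[Zhang2022LandauSiegel], §18 p. 100 (tex L4928–L4946) — an unrefereed manuscript under adjudication
(campaign D-0069, layer L4; cone leaf C27 `Skeleton.Ded183`; GAP-LEDGER row G-d56-1, component K2,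
the tools consumed by the range-evaluation edges «`Step18_range1/u010/u011b ⇐ Lemmas 10.1–10.2`»).
PROVED here from the definitions and the landed tools (`Section18RangeTools`, `…ToolsB`,
`Section18SjNormMajorant`):

* `norm_Sj23Range_le_majorant` — `‖Sj23Range(lo,hi)‖ ≤ Σ_{r,d∈[1,⌈PT⁻²⌉), lo≤dr<hi}
  ∏_{q∣dr}(1+25/q)/(drφ(r)) · ‖𝔳₁ⱼ(dr)‖ · ‖𝔳₂ⱼ(d,r)‖` (`log D ≥ 2`; K1 + `|λ₀ⱼ(n)| ≤ ∏(1+25/q)`);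
* `window_mass_le` — for `a ≥ 1/2`, `c ≥ 0`, `𝓛 ≥ 2`: the weight mass on the `T`-window
  `P^a/T < dr ≤ P^a` is `≤ 2e^{3c+2}(3 + 𝓛^{1.1})` (`sum_box_window_le` at `Y = ⌊P^a/T⌋`,
  `Z = ⌊P^a⌋`, `Z/Y ≤ 2T`, `log T = 𝓛^{1.1}`);
* `norm_PiW_le_prod` — `|Π(d,r)| ≤ ∏_{q∣dr}(1+2/q)²`; `prod25_mul_prod2_sq_le` — the combined
  weight `∏(1+25/q)∏(1+2/q)² ≤ ∏(1+106/q)`; `full_mass_le` — the full-range mass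
  `Σ_{dr≤Z} ∏_{q∣dr}(1+c/q)/(drφ(r)) ≤ 1 + 2e^{3c+2}(2 + log Z)`;
* `bigT_rpow_neg_mul_pow_le` — `T^{−c}𝓛^k ≤ (k+10)!·c^{−(k+10)}·𝓛⁻¹⁰` (`c > 0`, `𝓛 ≥ 1`): the
  `T^{−c}` of (10.2) beats every power of `𝓛`.

No claim of the manuscript is asserted; nothing bears on Theorems 1–2.

## References

* Y. Zhang, arXiv:2211.02515v1 (2022), §18 p. 100; §10 (10.2), (10.5), (10.8), (10.11); §6
  (`T = e^{𝓛^{1.1}}`). [cite: Zhang2022LandauSiegel, §18 p.100]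
-/

noncomputable section

open Complex Real Finset

namespace Literature.NumberTheory.LFunctions.Zhang2022.Sec18SjNorm

open Skeleton Typed.Section18

/-! ## The termwise majorant of a range piece -/

section Majorant

variable (c' : ℝ) {D : ℕ} (χ : DirichletCharacter ℂ D)

/-- **The termwise majorant of `Sj23Range`**: for `log D ≥ 2`, every `j` and every real `lo, hi`,
`‖Sj23Range c′ χ j lo hi‖ ≤ Σ_{r,d∈[1,⌈PT⁻²⌉), lo ≤ dr < hi} ∏_{q∣dr}(1+25/q)/(drφ(r))·‖𝔳₁ⱼ(dr)‖·‖𝔳₂ⱼ(d,r)‖`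
(K1 `sj23Term_eq_frakv`, `|χ(d)| ≤ 1`, `|μχ(r)| ≤ 1`, `|λ₀ⱼ(dr)| ≤ ∏_{q∣dr}(1+25/q)`).
[cite: Zhang2022LandauSiegel, §18 p.100] -/
theorem norm_Sj23Range_le_majorant (hD : 2 ≤ Real.log D) (j : ℕ) (lo hi : ℝ) :
    ‖Sj23Range c' χ j lo hi‖ ≤
      ∑ r ∈ Ico 1 (Nsupp D), ∑ d ∈ Ico 1 (Nsupp D),
        (if lo ≤ ((d * r : ℕ) : ℝ) ∧ ((d * r : ℕ) : ℝ) < hi then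
          (∏ q ∈ (d * r).primeFactors, (1 + 25 / (q : ℝ))) / ((d : ℝ) * r * Nat.totient r) *
            ‖frakv1 c' χ j ((d * r : ℕ) : ℝ)‖ * ‖frakv2 c' χ j d r‖ else 0) := by
  rw [Sj23Range]
  refine (norm_sum_le _ _).trans (sum_le_sum fun r hr => (norm_sum_le _ _).trans
    (sum_le_sum fun d hd => ?_))
  have hr1 : 1 ≤ r := (mem_Ico.mp hr).1
  have hd1 : 1 ≤ d := (mem_Ico.mp hd).1
  split_ifs with hcond
  · rw [sj23Term_eq_frakv c' χ hD j hr1 hd1]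
    have hdrR : (0 : ℝ) < ((d * r : ℕ) : ℝ) := by exact_mod_cast Nat.mul_pos hd1 hr1
    have hφ : (0 : ℝ) < Nat.totient r := by exact_mod_cast Nat.totient_pos.mpr hr1
    have hχd : ‖(((‖χ (d : ZMod D)‖ : ℝ) : ℂ))‖ ≤ 1 := by
      rw [Complex.norm_real, Real.norm_eq_abs, abs_norm]; exact DirichletCharacter.norm_le_one χ _
    have hμr : ‖(((‖((ArithmeticFunction.moebius r : ℤ) : ℂ) * χ (r : ZMod D)‖ : ℝ) : ℂ))‖ ≤ 1 := by
      rw [Complex.norm_real, Real.norm_eq_abs, abs_norm, norm_mul, Complex.norm_intCast]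
      have h1 : |((ArithmeticFunction.moebius r : ℤ) : ℝ)| ≤ 1 := by
        have := ArithmeticFunction.abs_moebius_le_one (n := r)
        exact_mod_cast this
      exact mul_le_one₀ h1 (norm_nonneg _) (DirichletCharacter.norm_le_one χ _)
    have hlam : ‖lamZero c' D j (d * r)‖ ≤ ∏ q ∈ (d * r).primeFactors, (1 + 25 / (q : ℝ)) := by
      have h := norm_lamZero_le c' D j (Nat.mul_ne_zero (by omega) (by omega) : d * r ≠ 0)
      refine h.trans (mul_le_of_le_one_right (prod_nonneg fun q _ => by positivity) ?_)
      rw [div_le_one (by exact_mod_cast Nat.mul_pos hd1 hr1)]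
      exact_mod_cast Nat.totient_le (d * r)
    have hden : ‖(((d * r : ℕ) : ℂ)) * (Nat.totient r : ℂ)‖ = (d : ℝ) * r * Nat.totient r := by
      rw [norm_mul, Complex.norm_natCast, Complex.norm_natCast]; push_cast; ring
    rw [norm_mul, norm_mul, norm_div, norm_mul, norm_mul, hden]
    have hpos : (0 : ℝ) < (d : ℝ) * r * Nat.totient r := by
      have : (0:ℝ) < d := by exact_mod_cast hd1
      have : (0:ℝ) < r := by exact_mod_cast hr1
      positivity
    gcongr
    · calc ‖(((‖χ (d : ZMod D)‖ : ℝ) : ℂ))‖ *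
            ‖(((‖((ArithmeticFunction.moebius r : ℤ) : ℂ) * χ (r : ZMod D)‖ : ℝ) : ℂ))‖ *
            ‖lamZero c' D j (d * r)‖
          ≤ 1 * 1 * ∏ q ∈ (d * r).primeFactors, (1 + 25 / (q : ℝ)) := by
            gcongr
        _ = ∏ q ∈ (d * r).primeFactors, (1 + 25 / (q : ℝ)) := by ring
  · simp

end Majorant

/-! ## The mass of a `T`-window -/

section WindowMass

variable {D : ℕ}

/-- **The weight mass on a `T`-window** (for the window clauses (10.5), (10.11) of Lemmas 10.1–10.2
as used in §18): for `c ≥ 0`, `a ≥ 1/2`, `𝓛 = log D ≥ 2` and any `N`,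
`Σ_{r,d∈[1,N), P^a/T < dr ≤ P^a} ∏_{q∣dr}(1+c/q)/(d·r·φ(r)) ≤ 2e^{3c+2}(3 + 𝓛^{1.1})`
(`sum_box_window_le` with `Y = ⌊P^a/T⌋ ≥ P^a/(2T)`, `Z = ⌊P^a⌋`, `log(Z/Y) ≤ log 2T ≤ 1 + 𝓛^{1.1}`).
[cite: Zhang2022LandauSiegel, §18 p.100; §10 (10.5), (10.11)] -/
theorem window_mass_le {c : ℝ} (hc : 0 ≤ c) {a : ℝ} (ha : 1 / 2 ≤ a)
    (hL : 2 ≤ ell D) (N : ℕ) :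
    ∑ r ∈ Ico 1 N, ∑ d ∈ Ico 1 N,
        (if bigP D ^ a / bigT D < ((d * r : ℕ) : ℝ) ∧ ((d * r : ℕ) : ℝ) ≤ bigP D ^ a then
          (∏ q ∈ (d * r).primeFactors, (1 + c / (q : ℝ))) / ((d : ℝ) * r * Nat.totient r) else 0) ≤
      2 * Real.exp (3 * c + 2) * (3 + ell D ^ (1.1 : ℝ)) := by
  have hℓ : 0 < ell D := by linarith
  have hP : 0 < bigP D := Real.exp_pos _
  have hPa : 0 < bigP D ^ a := Real.rpow_pos_of_pos hP a
  have hT : 0 < bigT D := Real.exp_pos _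
  have hT1 : 1 ≤ bigT D := Real.one_le_exp (by rw [ell] at hℓ ⊢; positivity)
  -- `P^a/T ≥ 2`: `a𝓛⁹ − 𝓛^{1.1} ≥ 𝓛⁹/2 − 𝓛² ≥ log 2`
  have hlogPaT : Real.log (bigP D ^ a / bigT D) = a * ell D ^ 9 - ell D ^ (1.1 : ℝ) := by
    rw [Real.log_div hPa.ne' hT.ne', Real.log_rpow hP, log_bigP, bigT, Real.log_exp]
  have h11 : ell D ^ (1.1 : ℝ) ≤ ell D ^ 2 := by
    calc ell D ^ (1.1 : ℝ) ≤ ell D ^ (2 : ℝ) :=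
          Real.rpow_le_rpow_of_exponent_le (by linarith) (by norm_num)
      _ = ell D ^ 2 := by norm_cast
  have hbig : 2 ≤ bigP D ^ a / bigT D := by
    have h9 : (2 : ℝ) ^ 9 ≤ ell D ^ 9 := pow_le_pow_left₀ (by norm_num) hL 9
    have h7 : ell D ^ 2 * 2 ^ 7 ≤ ell D ^ 9 := by
      have : (2 : ℝ) ^ 7 ≤ ell D ^ 7 := pow_le_pow_left₀ (by norm_num) hL 7
      nlinarith [pow_pos hℓ 2]
    have hlog2 : Real.log 2 ≤ 1 := by
      have := Real.log_lt_sub_one_of_pos (by norm_num : (0:ℝ) < 2) (by norm_num); linarith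
    have hge : Real.log 2 ≤ Real.log (bigP D ^ a / bigT D) := by
      rw [hlogPaT]; nlinarith
    exact (Real.log_le_log_iff (by norm_num) (div_pos hPa hT)).mp hge
  set Y : ℕ := ⌊bigP D ^ a / bigT D⌋₊ with hY
  set Z : ℕ := ⌊bigP D ^ a⌋₊ with hZ
  have hY1 : 1 ≤ Y := by
    rw [hY]; exact Nat.one_le_floor_iff _ |>.mpr (by linarith) 
  have hYle : (Y : ℝ) ≤ bigP D ^ a / bigT D := Nat.floor_le (div_pos hPa hT).le
  have hYge : bigP D ^ a / bigT D / 2 ≤ Y := by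
    have := Nat.lt_floor_add_one (bigP D ^ a / bigT D)
    rw [← hY] at this
    linarith
  have hZle : (Z : ℝ) ≤ bigP D ^ a := Nat.floor_le hPa.le
  have hPaT_le : bigP D ^ a / bigT D ≤ bigP D ^ a := div_le_self hPa.le hT1
  have hYZ : Y ≤ Z := Nat.floor_le_floor hPaT_le
  -- termwise: the real window implies the natural window `Y < dr ≤ Z`
  have hmono : ∀ r ∈ Ico 1 N, ∀ d ∈ Ico 1 N,
      (if bigP D ^ a / bigT D < ((d * r : ℕ) : ℝ) ∧ ((d * r : ℕ) : ℝ) ≤ bigP D ^ a then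
          (∏ q ∈ (d * r).primeFactors, (1 + c / (q : ℝ))) / ((d : ℝ) * r * Nat.totient r) else 0) ≤
        (if Y < d * r ∧ d * r ≤ Z then
          (∏ q ∈ (d * r).primeFactors, (1 + c / (q : ℝ))) / ((d : ℝ) * r * Nat.totient r) else 0) := by
    intro r _ d _
    have hnn : 0 ≤ (∏ q ∈ (d * r).primeFactors, (1 + c / (q : ℝ))) / ((d : ℝ) * r * Nat.totient r) :=
      div_nonneg (prod_nonneg fun q _ => by positivity) (by positivity)
    split_ifs with h1 h2
    · exact le_rfl
    · exfalso; apply h2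
      constructor
      · have : (Y : ℝ) < ((d * r : ℕ) : ℝ) := lt_of_le_of_lt hYle h1.1
        exact_mod_cast this
      · rw [hZ]; exact Nat.le_floor h1.2
    · exact hnn
    · exact le_rfl
  refine (sum_le_sum fun r hr => sum_le_sum fun d hd => hmono r hr d hd).trans ?_
  refine (sum_box_window_le hc hY1 hYZ N).trans ?_
  -- `log(Z/Y) ≤ log(2T) = log 2 + 𝓛^{1.1} ≤ 1 + 𝓛^{1.1}`
  have hYR : (0 : ℝ) < Y := by exact_mod_cast hY1
  have hratio : (Z : ℝ) / Y ≤ 2 * bigT D := by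
    rw [div_le_iff₀ hYR]
    calc (Z : ℝ) ≤ bigP D ^ a := hZle
      _ = 2 * bigT D * (bigP D ^ a / bigT D / 2) := by field_simp
      _ ≤ 2 * bigT D * Y := by gcongr
  have hlog2 : Real.log 2 ≤ 1 := by
    have := Real.log_lt_sub_one_of_pos (by norm_num : (0:ℝ) < 2) (by norm_num); linarith
  have hZY1 : (1 : ℝ) ≤ (Z : ℝ) / Y := by
    rw [le_div_iff₀ hYR]; exact_mod_cast (by simpa using hYZ)
  have hlogZY : Real.log ((Z : ℝ) / Y) ≤ 1 + ell D ^ (1.1 : ℝ) := by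
    calc Real.log ((Z : ℝ) / Y) ≤ Real.log (2 * bigT D) :=
          Real.log_le_log (by positivity) hratio
      _ = Real.log 2 + ell D ^ (1.1 : ℝ) := by rw [Real.log_mul (by norm_num) hT.ne', bigT, Real.log_exp]
      _ ≤ 1 + ell D ^ (1.1 : ℝ) := by linarith
  have := Real.exp_pos (3 * c + 2)
  nlinarith

end WindowMass

/-! ## The local factors `Π(d,r)` and the full-range mass -/

section PiBound

variable {D : ℕ} (χ : DirichletCharacter ℂ D)

/-- `(1 − 1/q)⁻¹ ≤ 1 + 2/q` for `q ≥ 2`. [folklore] -/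
private theorem inv_one_sub_inv_le {q : ℕ} (hq : 2 ≤ q) : (1 - 1 / (q : ℝ))⁻¹ ≤ 1 + 2 / (q : ℝ) := by
  have hqR : (2 : ℝ) ≤ q := by exact_mod_cast hq
  have hq0 : (0 : ℝ) < q := by linarith
  have hpos : 0 < 1 - 1 / (q : ℝ) := by rw [sub_pos, div_lt_one hq0]; linarith
  rw [inv_le_comm₀ hpos (by positivity)]
  -- `1/(1+2/q) ≤ 1 − 1/q` ⟺ `q ≤ (1 − 1/q)(q + 2)`... directly:
  rw [show (1 + 2 / (q : ℝ))⁻¹ = q / (q + 2) by field_simp, div_le_iff₀ (by linarith),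
    show (1 - 1 / (q : ℝ)) * (q + 2) = q + 1 - 2 / q by field_simp; ring]
  have : 2 / (q : ℝ) ≤ 1 := by rw [div_le_one hq0]; exact hqR
  linarith

/-- **`|Π(d,r)| ≤ ∏_{q∣dr}(1 + 2/q)²`** for `d, r ≥ 1` (Lemma 8.3's local factors,
`Skeleton.PiW`: `|(1 − χ(q)q⁻¹)⁻¹| ≤ (1 − q⁻¹)⁻¹ ≤ 1 + 2/q` and
`|(1 − q⁻¹ − χ(q)q⁻¹)/(1 − q⁻¹)| ≤ (1 − q⁻¹)⁻¹`). [cite: Zhang2022LandauSiegel, §8 Lemma 8.3] -/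
theorem norm_PiW_le_prod {d r : ℕ} (hd : d ≠ 0) (hr : r ≠ 0) :
    ‖PiW χ d r‖ ≤ ∏ q ∈ (d * r).primeFactors, (1 + 2 / (q : ℝ)) ^ 2 := by
  have hfac : ∀ q ∈ (d * r).primeFactors, (2 : ℝ) ≤ q ∧ ‖χ (q : ZMod D) * (q : ℂ)⁻¹‖ ≤ 1 / q := by
    intro q hq
    have hqp := Nat.prime_of_mem_primeFactors hq
    refine ⟨by exact_mod_cast hqp.two_le, ?_⟩
    rw [norm_mul, norm_inv, Complex.norm_natCast, one_div]
    exact mul_le_of_le_one_left (by positivity) (DirichletCharacter.norm_le_one χ _)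
  -- first product
  have hA : ‖∏ q ∈ (d * r).primeFactors, (1 - χ (q : ZMod D) * (q : ℂ)⁻¹)⁻¹‖ ≤
      ∏ q ∈ (d * r).primeFactors, (1 + 2 / (q : ℝ)) := by
    rw [norm_prod]
    refine prod_le_prod (fun q _ => norm_nonneg _) fun q hq => ?_
    obtain ⟨hq2, hχq⟩ := hfac q hq
    have hq0 : (0 : ℝ) < q := by linarith
    have hlow : 1 - 1 / (q : ℝ) ≤ ‖1 - χ (q : ZMod D) * (q : ℂ)⁻¹‖ := by
      calc 1 - 1 / (q : ℝ) ≤ ‖(1 : ℂ)‖ - ‖χ (q : ZMod D) * (q : ℂ)⁻¹‖ := by rw [norm_one]; linarith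
        _ ≤ ‖1 - χ (q : ZMod D) * (q : ℂ)⁻¹‖ := norm_sub_norm_le _ _
    have hpos : 0 < 1 - 1 / (q : ℝ) := by rw [sub_pos, div_lt_one hq0]; linarith
    rw [norm_inv]
    calc ‖1 - χ (q : ZMod D) * (q : ℂ)⁻¹‖⁻¹ ≤ (1 - 1 / (q : ℝ))⁻¹ :=
          inv_anti₀ hpos hlow
      _ ≤ 1 + 2 / (q : ℝ) := inv_one_sub_inv_le (by exact_mod_cast hq2)
  -- second product (over a subset of the prime factors of `dr`)
  have hsub : d.primeFactors.filter (fun q => Nat.Coprime q r) ⊆ (d * r).primeFactors := by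
    intro q hq
    rw [mem_filter] at hq
    rw [Nat.primeFactors_mul hd hr, mem_union]
    exact Or.inl hq.1
  have hB : ‖∏ q ∈ d.primeFactors.filter (fun q => Nat.Coprime q r),
      (1 - (q : ℂ)⁻¹ - χ (q : ZMod D) * (q : ℂ)⁻¹) / (1 - (q : ℂ)⁻¹)‖ ≤
      ∏ q ∈ (d * r).primeFactors, (1 + 2 / (q : ℝ)) := by
    rw [norm_prod]
    calc ∏ q ∈ d.primeFactors.filter (fun q => Nat.Coprime q r),
          ‖(1 - (q : ℂ)⁻¹ - χ (q : ZMod D) * (q : ℂ)⁻¹) / (1 - (q : ℂ)⁻¹)‖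
        ≤ ∏ q ∈ d.primeFactors.filter (fun q => Nat.Coprime q r), (1 + 2 / (q : ℝ)) := by
          refine prod_le_prod (fun q _ => norm_nonneg _) fun q hq => ?_
          obtain ⟨hq2, hχq⟩ := hfac q (hsub hq)
          have hq0 : (0 : ℝ) < q := by linarith
          have hq1 : ‖(q : ℂ)⁻¹‖ = 1 / q := by rw [norm_inv, Complex.norm_natCast, one_div]
          have hden : ‖1 - (q : ℂ)⁻¹‖ = 1 - 1 / (q : ℝ) := by
            have : (1 : ℂ) - (q : ℂ)⁻¹ = ((1 - 1 / (q : ℝ) : ℝ) : ℂ) := by push_cast; ring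
            rw [this, Complex.norm_real, Real.norm_of_nonneg]
            rw [sub_nonneg, div_le_one hq0]; linarith
          have hpos : 0 < 1 - 1 / (q : ℝ) := by rw [sub_pos, div_lt_one hq0]; linarith
          have hnum : ‖1 - (q : ℂ)⁻¹ - χ (q : ZMod D) * (q : ℂ)⁻¹‖ ≤ 1 := by
            calc ‖1 - (q : ℂ)⁻¹ - χ (q : ZMod D) * (q : ℂ)⁻¹‖
                ≤ ‖1 - (q : ℂ)⁻¹‖ + ‖χ (q : ZMod D) * (q : ℂ)⁻¹‖ := norm_sub_le _ _
              _ ≤ (1 - 1 / (q : ℝ)) + 1 / q := by rw [hden]; exact add_le_add le_rfl hχq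
              _ = 1 := by ring
          rw [norm_div, hden, div_le_iff₀ hpos]
          calc ‖1 - (q : ℂ)⁻¹ - χ (q : ZMod D) * (q : ℂ)⁻¹‖ ≤ 1 := hnum
            _ = (1 - 1 / (q : ℝ))⁻¹ * (1 - 1 / (q : ℝ)) := (inv_mul_cancel₀ hpos.ne').symm
            _ ≤ (1 + 2 / (q : ℝ)) * (1 - 1 / (q : ℝ)) :=
                mul_le_mul_of_nonneg_right (inv_one_sub_inv_le (by exact_mod_cast hq2)) hpos.le
      _ ≤ ∏ q ∈ (d * r).primeFactors, (1 + 2 / (q : ℝ)) := by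
          rw [← prod_sdiff hsub]
          refine le_mul_of_one_le_left (prod_nonneg fun q _ => by positivity) ?_
          exact Finset.one_le_prod fun q _ => by
            have : 0 ≤ 2 / (q : ℝ) := by positivity
            linarith
  rw [PiW, norm_mul]
  calc ‖∏ q ∈ (d * r).primeFactors, (1 - χ (q : ZMod D) * (q : ℂ)⁻¹)⁻¹‖ *
        ‖∏ q ∈ d.primeFactors.filter (fun q => Nat.Coprime q r),
          (1 - (q : ℂ)⁻¹ - χ (q : ZMod D) * (q : ℂ)⁻¹) / (1 - (q : ℂ)⁻¹)‖
      ≤ (∏ q ∈ (d * r).primeFactors, (1 + 2 / (q : ℝ))) *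
          ∏ q ∈ (d * r).primeFactors, (1 + 2 / (q : ℝ)) :=
        mul_le_mul hA hB (norm_nonneg _) (prod_nonneg fun q _ => by positivity)
    _ = ∏ q ∈ (d * r).primeFactors, (1 + 2 / (q : ℝ)) ^ 2 := by rw [← prod_mul_distrib]; simp [sq]

omit χ in
/-- The combined weight: `∏_{q∣n}(1 + 25/q)·∏_{q∣n}(1 + 2/q)² ≤ ∏_{q∣n}(1 + 106/q)`
(`(1+25/q)(1+2/q)² ≤ 1 + 106/q` for `q ≥ 2`) — the weight `|λ₀ⱼ(dr)||Π(d,r)|` of the §18 error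
terms. [cite: Zhang2022LandauSiegel, §18 p.100] -/
theorem prod25_mul_prod2_sq_le (n : ℕ) :
    (∏ q ∈ n.primeFactors, (1 + 25 / (q : ℝ))) * ∏ q ∈ n.primeFactors, (1 + 2 / (q : ℝ)) ^ 2 ≤
      ∏ q ∈ n.primeFactors, (1 + 106 / (q : ℝ)) := by
  rw [← prod_mul_distrib]
  refine prod_le_prod (fun q _ => by positivity) fun q hq => ?_
  have hq2 : (2 : ℝ) ≤ q := by exact_mod_cast (Nat.prime_of_mem_primeFactors hq).two_le
  have hq0 : (0 : ℝ) < q := by linarith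
  -- with `x = 1/q ∈ (0, 1/2]`: `(1+25x)(1+2x)² = 1 + 29x + 104x² + 100x³ ≤ 1 + 106x`
  set x : ℝ := 1 / (q : ℝ) with hx
  have hx0 : 0 < x := by positivity
  have hx1 : x ≤ 1 / 2 := by rw [hx, div_le_div_iff₀ hq0 (by norm_num)]; linarith
  have e1 : (1 + 25 / (q : ℝ)) * (1 + 2 / (q : ℝ)) ^ 2 = (1 + 25 * x) * (1 + 2 * x) ^ 2 := by
    rw [hx]; ring
  have e2 : 1 + 106 / (q : ℝ) = 1 + 106 * x := by rw [hx]; ring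
  rw [e1, e2]
  nlinarith [mul_nonneg hx0.le (by linarith : (0:ℝ) ≤ 1 / 2 - x), sq_nonneg x,
    mul_nonneg (sq_nonneg x) (by linarith : (0:ℝ) ≤ 1 / 2 - x)]

/-- **The full-range weight mass**: for `c ≥ 0`, `1 ≤ Z` and any `N`,
`Σ_{r,d∈[1,N), dr≤Z} ∏_{q∣dr}(1+c/q)/(d·r·φ(r)) ≤ 1 + 2e^{3c+2}(2 + log Z)` (the pair `d = r = 1`
plus `sum_box_window_le` on `1 < dr ≤ Z`). [cite: Zhang2022LandauSiegel, §18 p.100] -/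
theorem full_mass_le {c : ℝ} (hc : 0 ≤ c) {Z : ℕ} (hZ : 1 ≤ Z) (N : ℕ) :
    ∑ r ∈ Ico 1 N, ∑ d ∈ Ico 1 N,
        (if d * r ≤ Z then
          (∏ q ∈ (d * r).primeFactors, (1 + c / (q : ℝ))) / ((d : ℝ) * r * Nat.totient r) else 0) ≤
      1 + 2 * Real.exp (3 * c + 2) * (2 + Real.log Z) := by
  -- split the indicator `dr ≤ Z` into `dr = 1` and `1 < dr ≤ Z`
  have hsplit : ∀ r ∈ Ico 1 N, ∀ d ∈ Ico 1 N,
      (if d * r ≤ Z then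
          (∏ q ∈ (d * r).primeFactors, (1 + c / (q : ℝ))) / ((d : ℝ) * r * Nat.totient r) else 0) ≤
        (if d = 1 ∧ r = 1 then (1 : ℝ) else 0) +
        (if 1 < d * r ∧ d * r ≤ Z then
          (∏ q ∈ (d * r).primeFactors, (1 + c / (q : ℝ))) / ((d : ℝ) * r * Nat.totient r) else 0) := by
    intro r hr d hd
    have hr1 : 1 ≤ r := (mem_Ico.mp hr).1
    have hd1 : 1 ≤ d := (mem_Ico.mp hd).1
    have hnn : 0 ≤ (∏ q ∈ (d * r).primeFactors, (1 + c / (q : ℝ))) / ((d : ℝ) * r * Nat.totient r) :=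
      div_nonneg (prod_nonneg fun q _ => by positivity) (by positivity)
    by_cases hZ' : d * r ≤ Z
    · rw [if_pos hZ']
      by_cases h11 : d = 1 ∧ r = 1
      · obtain ⟨rfl, rfl⟩ := h11
        simp
      · have hlt : 1 < d * r := by
          rcases Nat.lt_or_ge 1 (d * r) with h | h
          · exact h
          · exfalso; apply h11
            have : d * r = 1 := le_antisymm h (Nat.mul_pos hd1 hr1)
            exact ⟨Nat.eq_one_of_mul_eq_one_right this, Nat.eq_one_of_mul_eq_one_left this⟩
        rw [if_neg h11, if_pos ⟨hlt, hZ'⟩, zero_add]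
    · have h2 : ¬(1 < d * r ∧ d * r ≤ Z) := fun h => hZ' h.2
      rw [if_neg hZ', if_neg h2, add_zero]
      split_ifs <;> norm_num
  refine (sum_le_sum fun r hr => sum_le_sum fun d hd => hsplit r hr d hd).trans ?_
  simp only [sum_add_distrib]
  have hone : ∑ r ∈ Ico 1 N, ∑ d ∈ Ico 1 N, (if d = 1 ∧ r = 1 then (1 : ℝ) else 0) ≤ 1 := by
    calc ∑ r ∈ Ico 1 N, ∑ d ∈ Ico 1 N, (if d = 1 ∧ r = 1 then (1 : ℝ) else 0)
        ≤ ∑ r ∈ Ico 1 N, (if r = 1 then (1 : ℝ) else 0) := by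
          refine sum_le_sum fun r _ => ?_
          by_cases hr1 : r = 1
          · subst hr1
            calc ∑ d ∈ Ico 1 N, (if d = 1 ∧ 1 = 1 then (1 : ℝ) else 0)
                = ∑ d ∈ Ico 1 N, (if d = 1 then (1 : ℝ) else 0) := by simp
              _ ≤ 1 := by
                  rw [sum_ite_eq']
                  split_ifs
                  all_goals norm_num
          · simp [hr1]
      _ ≤ 1 := by
          rw [sum_ite_eq']
          split_ifs
          all_goals norm_num
  have hwin := sum_box_window_le hc (le_refl 1) hZ N
  rw [Nat.cast_one, div_one] at hwin
  linarith

end PiBound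

/-! ## `T^{−c}` beats every power of `𝓛` -/

section Tpow

variable {D : ℕ}

/-- **`T^{−c}·𝓛^k ≤ (k+10)!·c^{−(k+10)}·𝓛⁻¹⁰`** for `c > 0` and `𝓛 = log D ≥ 1` (`T = e^{𝓛^{1.1}} ≥ e^{𝓛}`
and `e^{x} ≥ x^{k+10}/(k+10)!`): the `T^{−c}` of (10.2) beats every power of `𝓛`.
[cite: Zhang2022LandauSiegel, §10 (10.2); §6 p.30 (`T`)] -/
theorem bigT_rpow_neg_mul_pow_le {c : ℝ} (hc : 0 < c) (k : ℕ) (hL : 1 ≤ ell D) :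
    bigT D ^ (-c) * ell D ^ k ≤ ((k + 10).factorial : ℝ) / c ^ (k + 10) / ell D ^ 10 := by
  have hℓ : 0 < ell D := by linarith
  have hx : 0 ≤ c * ell D := by positivity
  -- `T^{-c} = exp(-c 𝓛^{1.1}) ≤ exp(-c 𝓛)`
  have hT : bigT D ^ (-c) = Real.exp (-(c * ell D ^ (1.1 : ℝ))) := by
    rw [bigT, ← Real.exp_mul]; ring_nf
  have h11 : ell D ≤ ell D ^ (1.1 : ℝ) := by
    calc ell D = ell D ^ (1 : ℝ) := (Real.rpow_one _).symm
      _ ≤ ell D ^ (1.1 : ℝ) := Real.rpow_le_rpow_of_exponent_le hL (by norm_num)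
  have hexp : bigT D ^ (-c) ≤ Real.exp (-(c * ell D)) := by
    rw [hT]; exact Real.exp_le_exp.mpr (by nlinarith)
  -- `exp(c𝓛) ≥ (c𝓛)^{k+10}/(k+10)!`
  have hfac := Real.pow_div_factorial_le_exp (x := c * ell D) hx (k + 10)
  have hfpos : (0 : ℝ) < ((k + 10).factorial : ℝ) := by exact_mod_cast Nat.factorial_pos _
  have hck : 0 < (c * ell D) ^ (k + 10) := by positivity
  have hexp' : Real.exp (-(c * ell D)) ≤ ((k + 10).factorial : ℝ) / (c * ell D) ^ (k + 10) := by
    rw [Real.exp_neg, inv_eq_one_div, div_le_div_iff₀ (Real.exp_pos _) hck]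
    rw [div_le_iff₀ hfpos] at hfac
    linarith
  calc bigT D ^ (-c) * ell D ^ k ≤ ((k + 10).factorial : ℝ) / (c * ell D) ^ (k + 10) * ell D ^ k := by
        gcongr; exact hexp.trans hexp'
    _ = ((k + 10).factorial : ℝ) / c ^ (k + 10) / ell D ^ 10 := by
        rw [mul_pow]; field_simp; ring

end Tpow

end Literature.NumberTheory.LFunctions.Zhang2022.Sec18SjNorm
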